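import Summits.BirchSwinnertonDyer.BirchSwinnertonDyer.Theorems.ResidualThetaTransportAtTwoResidualSignedLambdaLowerCMAtTwoStationRValuesPrep
import Summits.BirchSwinnertonDyer.BirchSwinnertonDyer.Theorems.ResidualThetaTransportAtTwoResidualSignedLambdaLowerCMAtTwoStationRTransfer
import Summits.BirchSwinnertonDyer.BirchSwinnertonDyer.Theorems.ResidualThetaTransportAtTwoResidualSignedLambdaLowerCMAtTwoStationRDictionary
import Summits.BirchSwinnertonDyer.BirchSwinnertonDyer.Theorems.ResidualThetaTransportAtTwoResidualSignedLambdaLowerCMAtTwoMazurTateValuesAtDatum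
import Summits.BirchSwinnertonDyer.BirchSwinnertonDyer.Theorems.ResidualThetaTransportAtTwoResidualSignedLambdaLowerCMAtTwoColemanPlusTorsor
import Summits.BirchSwinnertonDyer.BirchSwinnertonDyer.Theorems.ResidualThetaTransportAtTwoResidualThetaMainConjectureAtTwoEvalK
import HarnessLib

/-!
# Station (R) of line `onepair` (crux RSL_g, stmt-BirchSwinnertonDyer-22608) — file R4b: THE VALUES IDENTITY
# `3·q·δ · (𝔯̃_e · μ̃)(ζ−1) · θ^ι_{2m}(g;Ω)(ζ−1) = −((−1)^m ω⁻_{2m})(ζ−1) · (U · e(𝒸 z))(ζ−1)` at every primitive `ζ ∈ μ_{2^{2m}}(ℂ₂)`, `m ≥ 1`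

Route `ResidualThetaTransportAtTwo` (RTT), crux `ResidualSignedLambdaLowerCMAtTwo` (stmt-BirchSwinnertonDyer-22608), line `onepair` v3f, station (R)
`stub_kzgValueRelation`. Seat `bsd-wall-tp2-p2x-w3` g18 (width seat; helper, `--supports … --as helper`, closes nothing). THEOREMS ONLY (no definition,
no instance, no notation, no `sorry`). BSD is not proved by anything here; 22608 / 26074 / 24105 OPEN / HOLD.

WHAT (memo `STATION-R-PORT-w3g18.md`, evidence #54 on 22608; findings F1/F2/F4; plan (P2)). `values_identity`: for the pins `π`, a frame `F`, a class `z`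
with (BKρ) `π.KatoBKCoord F.Φ F.τ z c′ w` and (VALρ) `π.KatoValCoord g ι Ω F.τ w q μt`, and an `ι₀`-semilinear trivialisation `e` satisfying the (E)-clause
`e(𝒸((C y)•z)) = C y · e(𝒸 z)` (`y ∈ 𝒪`), there are the trace dual `δ ≠ 0` of `π.t₀` and a unit `U ∈ ℤ₂⟦X⟧ˣ` (the Coleman-plus torsor of the displayed plus
Honda datum through `F`) such that for every `m ≥ 1` and every primitive `ζ ∈ ℂ₂` of order `2^{2m}`:
`(3·q·δ) · (𝔯̃_e · μ̃)(ζ−1) · θ^ι_{2m}(ζ−1) = −((−1)^m ω⁻_{2m})(ζ−1) · (U · e(𝒸 z))(ζ−1)`, `𝔯̃_e := Σ_i C(c′_i) · e(δ_i)` — the EV-C(u)-shaped input of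
`StationR.Road.hERL_of_scaledColumnValues_fixedMultiplier` with multiplier `𝔯̃_e · μ̃` (`δ(ζ−1)`-free: only values). Chain: characters from `ζ`
(`exists_even_primitive_char_of_isPrimitiveRoot`) → dictionary per coordinate (`sum_pow_mul_pair_single_eq`) → bridge (`tsum_apply_coe_eq_sum`) → evaluated
equivariance (`tsum_apply_smul_eq_mul_tsum_of_equivariant`) → Dedekind transfer (`sum_mul_values_eq_of_equivariant`) → (VALρ) → H-MT
(`ResidualThetaLayer.eval₂_map_mazurTateElementK_eq_sum`); column side: H1 (`MazurTateValuesRelay.exists_colemanPlusHom_two_of_datum`), torsor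
(`OnePairPins.exists_unit_mul_col_of_pin`), COL-ev (`tsum_apply_eq_neg_mul_of_cong`).

References: [Kato2004Asterisque] Thm. 12.5 (1) (pp. 221–222), §15.16 (p. 265); [BlochKato1990] §3 (3.10.1), (3.11); [Kobayashi2003] Thm. 6.2, (8.23),
Prop. 8.25–8.26; [Pollack2003] Prop. 6.9, Prop. 6.18; [Lang2002] Ch. VI §4 Thm. 4.1.
-/

set_option autoImplicit false
-- D-0017: single-problem summit, so `Summit.BirchSwinnertonDyer.BirchSwinnertonDyer.…` repeats a namespace BY DESIGN.
set_option linter.dupNamespace false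
set_option backward.isDefEq.respectTransparency false

noncomputable section

open scoped Classical NumberField Polynomial

open Polynomial (X C)
open NumberField IsDedekindDomain WeierstrassCurve Field Literature.NumberTheory.EllipticCurves
  Literature.NumberTheory.EllipticCurves.ModularForms
  Literature.NumberTheory.GaloisRepresentations Literature.NumberTheory.EllipticCurves.GreenbergSelmer
  Literature.NumberTheory.EllipticCurves.Rank1Residual Literature.NumberTheory.EllipticCurves.Kobayashi2003
  Literature.NumberTheory.EllipticCurves.FormalGroupChart Literature.NumberTheory.EllipticCurves.ZpExtension
  Literature.NumberTheory.EllipticCurves.Sprung2012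
  Summit.BirchSwinnertonDyer.Rank1Residual.Additive Summit.BirchSwinnertonDyer.Rank1Residual.Additive.PadicCyclotomicTower
  Summit.BirchSwinnertonDyer.Rank1Residual.Additive.BallEval Summit.BirchSwinnertonDyer.Rank1Residual.Additive.LocalTransport
  Summit.BirchSwinnertonDyer.BirchSwinnertonDyer.Theorems.SignedKatoOffTwo
  Summit.BirchSwinnertonDyer.BirchSwinnertonDyer.Theorems.OnePair
  Rat.HeightOneSpectrum

namespace Summit.BirchSwinnertonDyer.BirchSwinnertonDyer.Theorems.ThetaTransport.StationR

section Values

variable {S : Set (PadicAlgCl 2)} {W : WeierstrassCurve ℚ} [W.IsElliptic] [W.IsGloballyMinimal] {κ : ZpExtension ℚ 2} {γ : absoluteGaloisGroup ℚ}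
  {S₀ : Finset (HeightOneSpectrum (𝓞 ℚ))} {n : ℕ} {ρ : FramedGaloisRep ℚ ↥(padicCoeffIntegers S) 2}
  {Θ : ∀ v : HeightOneSpectrum (𝓞 ℚ), ((2 : ℕ) : 𝓞 ℚ) ∈ v.asIdeal → (Cofree ρ ↥(padicCoeffField S) ≃+ (Fin n → ↥(W.geomPrimaryTorsion 2)))}
  {hΘ : ∀ v hv (δ : absoluteGaloisGroup (v.adicCompletion ℚ)) m i,
    Θ v hv (resGalOfEmb (closureEmb (K := ℚ) (v.adicCompletion ℚ)) δ • m) i = resGalOfEmb (closureEmb (K := ℚ) (v.adicCompletion ℚ)) δ • Θ v hv m i}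
  {I : Kato2004.IwasawaH1DataCoeff (FramedGaloisRep.toGaloisRep ρ) 2 κ γ}
  {Sg : AddSubgroup (subgroupH1 κ.kerSubgroup (Cofree ρ ↥(padicCoeffField S)))} [Module ↥(padicCoeffIntegers S) ↥Sg]
  {M : ℕ} [NeZero M] (g : CuspForm (CongruenceSubgroup.Gamma0 M) 2) (ι : coeffField g →+* PadicAlgCl 2) (Ω : ℂ)

/-- `Pi.single i ⟨P, h⟩` into a subtype, read pointwise. [folklore: plumbing] -/
theorem coe_pi_single_mk {α : Type*} [AddCommGroup α] (A : AddSubgroup α) (i i' : Fin n) (P : α) (h : P ∈ A) :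
    ((Pi.single i (⟨P, h⟩ : ↥A) : Fin n → ↥A) i' : α) = (Pi.single i P : Fin n → α) i' := by
  by_cases hi : i' = i
  · subst hi; simp
  · simp [Pi.single_eq_of_ne hi]

set_option maxHeartbeats 3200000 in
/-- **THE VALUES IDENTITY of station (R)** (see the module docstring). For every `m ≥ 1` and every primitive `ζ ∈ μ_{2^{2m}}(ℂ₂)`:
`(3·q·δ) · (𝔯̃_e · μ̃)(ζ−1) · θ^ι_{2m}(g;Ω)(ζ−1) = −((−1)^m ω⁻_{2m})(ζ−1) · (U · e(𝒸 z))(ζ−1)`, `δ` the trace dual of `t₀` (`δ ≠ 0` from (ND)), `U` the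
Coleman-plus torsor unit of the plus Honda datum displayed through `F`. Uses (BKρ), (VALρ), (ND), the (E)-clauses of `e`; CONDITIONAL on nothing else.
BSD / RSL_g / KZ_g are NOT proved by this. [cite: Kato2004Asterisque, Thm. 12.5 (1) (pp. 221–222), §15.16 (p. 265)] [cite: BlochKato1990, §3 (3.10.1), (3.11)]
[cite: Kobayashi2003, Thm. 6.2, (8.23) (p. 18), Prop. 8.25–8.26 (pp. 24–25)] [cite: Pollack2003, Prop. 6.9, Prop. 6.18] -/
theorem values_identity [FiniteDimensional ℚ_[2] (padicCoeffField S)]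
    (hss : GoodSS W 2) (ha : W.frobeniusTrace 2 = 0) (hκ : κ.IsCyclotomic) (hγ : κ.IsTopGenerator γ) (hcv : IsCyclotomicVariable 2 γ)
    (π : OnePairPins S W κ γ S₀ n ρ Θ hΘ I Sg) (F : π.KatoFrame) (z : I.H)
    (c' : Fin n → ↥(padicCoeffIntegers S)) (w : ℕ → Fin π.nb → PadicAlgCl 2) (q : PadicAlgCl 2) (μt : IwasawaAlgebraO S)
    (hND : π.CoordNondeg c') (hBK : π.KatoBKCoord F.Φ F.τ z c' w) (hVAL : π.KatoValCoord g ι Ω F.τ w q μt)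
    (e : (Fin n → PowerSeries ℤ_[2]) ≃+ IwasawaAlgebraO S)
    (he : ∀ (r : PowerSeries ℤ_[2]) (t : Fin n → PowerSeries ℤ_[2]), e (r • t) = PowerSeries.map (padicIntToCoeffIntegers S) r * e t)
    (hlin : ∀ y : ↥(padicCoeffIntegers S), e (π.cvec ((PowerSeries.C y : IwasawaAlgebraO S) • z)) = PowerSeries.C y * e (π.cvec z)) :
    ∃ (δ : padicCoeffField S) (U : (PowerSeries ℤ_[2])ˣ), δ ≠ 0 ∧
      ∀ m : ℕ, 1 ≤ m → ∀ ζ : ℂ_[2], IsPrimitiveRoot ζ (2 ^ (2 * m)) →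
        algebraMap (PadicAlgCl 2) ℂ_[2] (3 * q * (δ : PadicAlgCl 2)) *
            (∑' k, ((algebraMap (PadicAlgCl 2) ℂ_[2]).comp (padicCoeffIntegers S).subtype)
              (PowerSeries.coeff k ((∑ i : Fin n, PowerSeries.C (c' i) * e (Pi.single i 1)) * μt)) * (ζ - 1) ^ k) *
          ((mazurTateElementK g Ω 2 (2 * m)).map ι).eval₂ (algebraMap (PadicAlgCl 2) ℂ_[2]) (ζ - 1) =
        -(((-1 : ℤ[X]) ^ m * cyclotomicOmegaMinus 2 (2 * m)).eval₂ (Int.castRingHom ℂ_[2]) (ζ - 1)) *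
          ∑' k, ((algebraMap (PadicAlgCl 2) ℂ_[2]).comp (padicCoeffIntegers S).subtype)
            (PowerSeries.coeff k (PowerSeries.map (padicIntToCoeffIntegers S) (U : PowerSeries ℤ_[2]) * e (π.cvec z))) * (ζ - 1) ^ k := by
  have hv2 : (2 : 𝓞 ℚ) ∈ π.v.asIdeal := by simpa using π.hv
  -- (1) the displayed plus Honda datum through `F` and the local variable
  obtain ⟨ιF, hcompat, cc, σσ, d₀, d, hcΩ, hcstab, hσσ, hd₀, hd₀L, hdT, hdL, hTR, hGEN, hGEN0⟩ :=
    exists_plusHondaDatum_of_frame W hss ha κ hκ π.v hv2 F.Φ F.φ F.hΦφ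
  obtain ⟨g₀, gv, -, -, hgen, -, -, hζpow, -, hTg⟩ := LocalVar.exists_localVariable_two hκ hγ hcv π.v F.Φ F.φ F.hΦφ ιF hcompat
  have hdA : ∀ m j, gv ^ j • d m ∈ localTowerPointsOfEmb κ (closureEmb (K := ℚ) (π.v.adicCompletion ℚ)) W := fun m j =>
    localLayerPointsOfEmb_le_localTowerPointsOfEmb κ (closureEmb (K := ℚ) (π.v.adicCompletion ℚ)) W m
      (smul_mem_localLayerPointsOfEmb κ (closureEmb (K := ℚ) (π.v.adicCompletion ℚ)) W m (gv ^ j) (hdL m))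
  -- (2) H1: the plus Coleman map along the datum; torsor unit against the pins' `col`
  obtain ⟨colc, hcongc, hpinc, hsurjc, hkerc⟩ :=
    MazurTateValuesRelay.exists_colemanPlusHom_two_of_datum W hss κ hκ π.v hv2 gv hgen d hdL hTR hGEN hGEN0 hdA ℤ_[2]
  obtain ⟨U, -, hcongU⟩ := π.exists_unit_mul_col_of_pin colc gv d hdA hgen hdL hcongc hpinc hsurjc hkerc
  -- (3) the trace dual of `t₀`
  obtain ⟨t, δ, ht, hδ⟩ := exists_trace_mul_eq_padicInt S π.t₀ π.ht₀
  have ht0 : π.t₀ ≠ 0 := by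
    intro h0
    have h01 : (fun (a : ↥(padicCoeffIntegers S)) (i : Fin n) => π.t₀ (c' i * a)) 0 =
        (fun (a : ↥(padicCoeffIntegers S)) (i : Fin n) => π.t₀ (c' i * a)) 1 := by
      funext i; simp [h0]
    exact zero_ne_one (hND h01)
  have hδ0 : δ ≠ 0 := traceDual_ne_zero S π.t₀ t δ ht hδ ht0
  refine ⟨δ, U, hδ0, fun m hm ζ hζ => ?_⟩
  haveI : NeZero (2 ^ (2 * m + 2)) := ⟨pow_ne_zero _ two_ne_zero⟩
  have hζpow1 : ζ ^ 2 ^ (2 * m) = 1 := hζ.pow_eq_one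
  have hz : ‖ζ - 1‖ < 1 := norm_sub_one_lt_one_of_pow_prime_pow_eq_one hζpow1
  -- (4) characters from `ζ`
  obtain ⟨χ, ψ, heven, hord, hχ5, -, hχa, hevenψ, hprimψ⟩ := exists_even_primitive_char_of_isPrimitiveRoot m hm hζ
  -- shorthands
  set φ : ↥(padicCoeffIntegers S) →+* ℂ_[2] := (algebraMap (PadicAlgCl 2) ℂ_[2]).comp (padicCoeffIntegers S).subtype with hφdef
  set φ₀ : ℤ_[2] →+* ℂ_[2] := (algebraMap ℚ_[2] ℂ_[2]).comp PadicInt.Coe.ringHom with hφ₀def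
  have hφ₀ : ∀ v : ℤ_[2], φ₀ v = algebraMap (PadicAlgCl 2) ℂ_[2] (algebraMap ℚ_[2] (PadicAlgCl 2) (v : ℚ_[2])) := fun v => by
    rw [hφ₀def, RingHom.comp_apply, IsScalarTower.algebraMap_apply ℚ_[2] (PadicAlgCl 2) ℂ_[2]]; rfl
  -- the layer points of the orbit and the pairing values
  have hmemv : ∀ j : ℕ, gv ^ j • d (2 * m) ∈ localLayerPointsOfEmb κ (closureEmb (K := ℚ) (π.v.adicCompletion ℚ)) W (2 * m) :=
    fun j ↦ smul_mem_localLayerPointsOfEmb κ (closureEmb (K := ℚ) (π.v.adicCompletion ℚ)) W (2 * m) (gv ^ j) (hdL (2 * m))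
  -- the P-polynomials of a class, coordinatewise, along the datum at layer `2m`
  set Ppoly : I.H → Fin n → ℤ_[2][X] := fun x i =>
    ∑ j ∈ Finset.range (2 ^ (2 * m)), Polynomial.C (((π.locd₂ x).comp (AddMonoidHom.single
      (fun _ : Fin n => ↥(localTowerPointsOfEmb κ (closureEmb (K := ℚ) (π.v.adicCompletion ℚ)) W)) i))
      ⟨gv ^ j • d (2 * m), hdA (2 * m) j⟩) * (Polynomial.X + 1) ^ j with hPpoly
  set P : I.H → Fin n → PowerSeries ℤ_[2] := fun x i => (Ppoly x i : PowerSeries ℤ_[2]) with hPdef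
  set cU : PowerSeries ℤ_[2] := (-1 : PowerSeries ℤ_[2]) ^ m *
    (((cyclotomicOmegaMinus 2 (2 * m)).map (Int.castRingHom ℤ_[2]) : ℤ_[2][X]) : PowerSeries ℤ_[2]) * (U : PowerSeries ℤ_[2]) with hcU
  -- (5) the column congruence for `π.cvec` along the datum
  have hcong : ∀ (x : I.H) (i : Fin n), ((cyclotomicOmega 2 (2 * m)).map (Int.castRingHom ℤ_[2]) : PowerSeries ℤ_[2]) ∣ P x i + cU * π.cvec x i := by
    intro x i
    obtain ⟨r, hr⟩ := hcongU ((π.locd₂ x).comp (AddMonoidHom.single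
      (fun _ : Fin n => ↥(localTowerPointsOfEmb κ (closureEmb (K := ℚ) (π.v.adicCompletion ℚ)) W)) i)) m
    refine ⟨r, ?_⟩
    rw [← hr, hPdef, hcU, OnePairPins.cvec_apply]
    ring
  -- (6) the pairing values: glue ↔ layer pairing
  have hval : ∀ (x : I.H) (i : Fin n) (j : ℕ),
      ((π.locd₂ x).comp (AddMonoidHom.single
        (fun _ : Fin n => ↥(localTowerPointsOfEmb κ (closureEmb (K := ℚ) (π.v.adicCompletion ℚ)) W)) i))
        ⟨gv ^ j • d (2 * m), hdA (2 * m) j⟩ =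
      π.pair (2 * m) (I.proj (2 * m) x) (Pi.single i ⟨gv ^ j • d (2 * m), hmemv j⟩) := by
    intro x i j
    have hQ : ∀ i', (Pi.single i (gv ^ j • d (2 * m)) : Fin n → localPoints W (π.v.adicCompletion ℚ)) i' ∈
        localLayerPointsOfEmb κ (closureEmb (K := ℚ) (π.v.adicCompletion ℚ)) W (2 * m) := by
      intro i'
      by_cases hi : i' = i
      · subst hi; simp [hmemv j]
      · simp [Pi.single_eq_of_ne hi, zero_mem]
    have h1 := π.locd₂_layer (2 * m) x (Pi.single i (gv ^ j • d (2 * m))) hQ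
    have e1 : (Pi.single i (⟨gv ^ j • d (2 * m), hdA (2 * m) j⟩ :
        ↥(localTowerPointsOfEmb κ (closureEmb (K := ℚ) (π.v.adicCompletion ℚ)) W)) : Fin n → _) =
        fun i' => ⟨(Pi.single i (gv ^ j • d (2 * m)) : Fin n → localPoints W (π.v.adicCompletion ℚ)) i',
          localLayerPointsOfEmb_le_localTowerPointsOfEmb κ (closureEmb (K := ℚ) (π.v.adicCompletion ℚ)) W (2 * m) (hQ i')⟩ := by
      funext i'; apply Subtype.ext; exact coe_pi_single_mk _ i i' _ _
    have e2 : (fun i' => (⟨(Pi.single i (gv ^ j • d (2 * m)) : Fin n → localPoints W (π.v.adicCompletion ℚ)) i', hQ i'⟩ :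
        ↥(localLayerPointsOfEmb κ (closureEmb (K := ℚ) (π.v.adicCompletion ℚ)) W (2 * m)))) =
        Pi.single i ⟨gv ^ j • d (2 * m), hmemv j⟩ := by
      funext i'; apply Subtype.ext; exact (coe_pi_single_mk _ i i' _ _).symm
    rw [AddMonoidHom.comp_apply, AddMonoidHom.single_apply, e1, h1, e2]
  -- (7) the bridge: `e(P x)(ζ−1) = Σ_i ε_i · Σ_j φ₀(v_ij) ζ^j`
  have hbridge : ∀ x : I.H, ∑' k, φ (PowerSeries.coeff k (e (P x))) * (ζ - 1) ^ k =
      ∑ i : Fin n, (∑' k, φ (PowerSeries.coeff k (e (Pi.single i 1))) * (ζ - 1) ^ k) *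
        ∑ j ∈ Finset.range (2 ^ (2 * m)), φ₀ (π.pair (2 * m) (I.proj (2 * m) x) (Pi.single i ⟨gv ^ j • d (2 * m), hmemv j⟩)) * ζ ^ j := by
    intro x
    rw [hPdef]
    dsimp only
    have hb := tsum_apply_coe_eq_sum S e.toAddMonoidHom he (Ppoly x) hz
    simp only [AddEquiv.coe_toAddMonoidHom] at hb
    rw [hφdef, hb]
    refine Finset.sum_congr rfl fun i _ => ?_
    congr 1
    rw [hPpoly]
    dsimp only
    rw [Polynomial.eval₂_finsetSum]
    refine Finset.sum_congr rfl fun j _ => ?_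
    rw [Polynomial.eval₂_mul, Polynomial.eval₂_C, Polynomial.eval₂_pow, Polynomial.eval₂_add, Polynomial.eval₂_X, Polynomial.eval₂_one,
      sub_add_cancel, hval]
  -- (8) the dictionary at layer `2m` through `φ₀`, for every `y ∈ 𝒪`
  have hdict : ∀ (y : ↥(padicCoeffIntegers S)) (i : Fin n),
      ∑ j ∈ Finset.range (2 ^ (2 * m)),
          φ₀ (π.pair (2 * m) (I.proj (2 * m) ((PowerSeries.C y : IwasawaAlgebraO S) • z)) (Pi.single i ⟨gv ^ j • d (2 * m), hmemv j⟩)) * ζ ^ j =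
        algebraMap (PadicAlgCl 2) ℂ_[2] (3 * gaussSum ψ (AddChar.zmodChar (2 ^ (2 * m + 2)) (HondaLog.zeta_pow_prime_pow_self (p := 2) (2 * m + 2)))) *
          ∑ l : Fin π.nb, algebraMap ℚ_[2] ℂ_[2] ((π.t₀ (c' i * y * π.bO l) : ℤ_[2]) : ℚ_[2]) *
            algebraMap (PadicAlgCl 2) ℂ_[2] (∑ b : (ZMod (2 ^ (2 * m + 2)))ˣ,
              ψ⁻¹ (b : ZMod (2 ^ (2 * m + 2))) * F.τ (2 * m + 2) (b : ZMod (2 ^ (2 * m + 2))) • w (2 * m + 2) l) := by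
    intro y i
    have h := sum_pow_mul_pair_single_eq hκ π F ιF z c' w hBK hcΩ hcstab hσσ hd₀ hd₀L hdT hdL hζpow hTg (2 * m) y i ψ hevenψ hprimψ
    have h' := congrArg (algebraMap (PadicAlgCl 2) ℂ_[2]) h
    rw [map_sum, map_mul, map_sum] at h'
    have hlhs : ∑ j ∈ Finset.range (2 ^ (2 * m)),
          φ₀ (π.pair (2 * m) (I.proj (2 * m) ((PowerSeries.C y : IwasawaAlgebraO S) • z)) (Pi.single i ⟨gv ^ j • d (2 * m), hmemv j⟩)) * ζ ^ j =
        ∑ j ∈ Finset.range (2 ^ (2 * m)), algebraMap (PadicAlgCl 2) ℂ_[2] (ψ (5 : ZMod (2 ^ (2 * m + 2))) ^ j *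
          algebraMap ℚ_[2] (PadicAlgCl 2)
            ((π.pair (2 * m) (I.proj (2 * m) ((PowerSeries.C y : IwasawaAlgebraO S) • z))
              (Pi.single i ⟨gv ^ j • d (2 * m), hmemv j⟩) : ℤ_[2]) : ℚ_[2])) := by
      refine Finset.sum_congr rfl fun j _ => ?_
      rw [map_mul, map_pow, ← hχa, hχ5, hφ₀, mul_comm]
    rw [hlhs, h']
    refine congrArg _ (Finset.sum_congr rfl fun l _ => ?_)
    rw [map_mul, ← IsScalarTower.algebraMap_apply ℚ_[2] (PadicAlgCl 2) ℂ_[2]]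
  -- (9) the evaluated equivariance and the transfer
  set ε : Fin n → ℂ_[2] := fun i => ∑' k, φ (PowerSeries.coeff k (e (Pi.single i 1))) * (ζ - 1) ^ k with hεdef
  set G : ℂ_[2] := algebraMap (PadicAlgCl 2) ℂ_[2]
    (3 * gaussSum ψ (AddChar.zmodChar (2 ^ (2 * m + 2)) (HondaLog.zeta_pow_prime_pow_self (p := 2) (2 * m + 2)))) with hGdef
  set Wc : Fin π.nb → ℂ_[2] := fun l => algebraMap (PadicAlgCl 2) ℂ_[2] (∑ b : (ZMod (2 ^ (2 * m + 2)))ˣ,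
    ψ⁻¹ (b : ZMod (2 ^ (2 * m + 2))) * F.τ (2 * m + 2) (b : ZMod (2 ^ (2 * m + 2))) • w (2 * m + 2) l) with hWcdef
  have hePy : ∀ y : ↥(padicCoeffIntegers S), ∑' k, φ (PowerSeries.coeff k (e (P ((PowerSeries.C y : IwasawaAlgebraO S) • z)))) * (ζ - 1) ^ k =
      ∑ i : Fin n, ε i * (G * ∑ l : Fin π.nb, algebraMap ℚ_[2] ℂ_[2] (π.t₀ (c' i * y * π.bO l) : ℚ_[2]) * Wc l) := by
    intro y
    rw [hbridge]
    refine Finset.sum_congr rfl fun i _ => ?_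
    rw [hdict y i]
  have hz1 : (PowerSeries.C (1 : ↥(padicCoeffIntegers S)) : IwasawaAlgebraO S) • z = z := by rw [map_one, one_smul]
  have hLin : ∀ a : ↥(padicCoeffIntegers S),
      ∑ i : Fin n, ε i * (G * ∑ l : Fin π.nb, algebraMap ℚ_[2] ℂ_[2] (π.t₀ (c' i * a * π.bO l) : ℚ_[2]) * Wc l) =
        algebraMap (PadicAlgCl 2) ℂ_[2] (a : PadicAlgCl 2) *
          ∑ i : Fin n, ε i * (G * ∑ l : Fin π.nb, algebraMap ℚ_[2] ℂ_[2] (π.t₀ (c' i * π.bO l) : ℚ_[2]) * Wc l) := by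
    intro a
    have hB := tsum_apply_smul_eq_mul_tsum_of_equivariant S (2 * m) π.cvec P cU hcong e.toAddMonoidHom he z a (hlin a) hζpow1
    have h1 := hePy 1
    simp only [mul_one] at h1
    rw [hz1] at h1
    rw [← hePy a, ← h1]
    exact hB
  have hT := sum_mul_values_eq_of_equivariant S π.t₀ t δ ht hδ c' π.bO ε Wc G hLin
  -- (10) Kato's values (VALρ) at `ψ`, and the Mazur–Tate element at `χ`
  have hV := hVAL (2 * m) ψ hevenψ hprimψ
  have hMT : ((mazurTateElementK g Ω 2 (2 * m)).map ι).eval₂ (algebraMap (PadicAlgCl 2) ℂ_[2]) (χ (5 : ZMod (2 ^ (2 * m + 2))) - 1) =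
      ∑ a : ZMod (2 ^ (2 * m + 2)), χ a * algebraMap (PadicAlgCl 2) ℂ_[2] (ι (plusSymbolK g Ω ((a.val : ℚ) / (2 : ℚ) ^ (2 * m + 2)))) :=
    ResidualThetaLayer.eval₂_map_mazurTateElementK_eq_sum (n := 2 * m) g ι Ω χ heven hord
  rw [hχ5] at hMT
  have hVr : (∑ l : Fin π.nb, algebraMap (PadicAlgCl 2) ℂ_[2] (π.bO l : PadicAlgCl 2) * Wc l) *
      algebraMap (PadicAlgCl 2) ℂ_[2] (gaussSum ψ (AddChar.zmodChar (2 ^ (2 * m + 2)) (HondaLog.zeta_pow_prime_pow_self (p := 2) (2 * m + 2)))) =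
      algebraMap (PadicAlgCl 2) ℂ_[2] q * (∑' k, φ (PowerSeries.coeff k μt) * (ζ - 1) ^ k) *
        ((mazurTateElementK g Ω 2 (2 * m)).map ι).eval₂ (algebraMap (PadicAlgCl 2) ℂ_[2]) (ζ - 1) := by
    have hl : (∑ l : Fin π.nb, algebraMap (PadicAlgCl 2) ℂ_[2] (π.bO l : PadicAlgCl 2) * Wc l) *
        algebraMap (PadicAlgCl 2) ℂ_[2] (gaussSum ψ (AddChar.zmodChar (2 ^ (2 * m + 2)) (HondaLog.zeta_pow_prime_pow_self (p := 2) (2 * m + 2)))) =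
        algebraMap (PadicAlgCl 2) ℂ_[2] ((∑ j : Fin π.nb, ((π.bO j : ↥(padicCoeffIntegers S)) : PadicAlgCl 2) *
            ∑ b : (ZMod (2 ^ (2 * m + 2)))ˣ, ψ⁻¹ (b : ZMod (2 ^ (2 * m + 2))) * F.τ (2 * m + 2) (b : ZMod (2 ^ (2 * m + 2))) • w (2 * m + 2) j) *
          gaussSum ψ (AddChar.zmodChar (2 ^ (2 * m + 2)) (HondaLog.zeta_pow_prime_pow_self (p := 2) (2 * m + 2)))) := by
      rw [map_mul, map_sum]
      simp only [hWcdef, map_mul]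
    have hr : algebraMap (PadicAlgCl 2) ℂ_[2] (∑ a : ZMod (2 ^ (2 * m + 2)), ψ a * ι (plusSymbolK g Ω ((a.val : ℚ) / (2 : ℚ) ^ (2 * m + 2)))) =
        ((mazurTateElementK g Ω 2 (2 * m)).map ι).eval₂ (algebraMap (PadicAlgCl 2) ℂ_[2]) (ζ - 1) := by
      rw [hMT, map_sum]
      refine Finset.sum_congr rfl fun a _ => ?_
      rw [map_mul, hχa]
    have hζψ : algebraMap (PadicAlgCl 2) ℂ_[2] (ψ (5 : ZMod (2 ^ (2 * m + 2)))) = ζ := by rw [← hχa, hχ5]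
    rw [hl, hV, hr, hζψ]
    rfl
  -- (11) the column side, evaluated
  have hcol := tsum_apply_eq_neg_mul_of_cong S (2 * m) (P z) (π.cvec z) cU (fun i => hcong z i) e.toAddMonoidHom he hζpow1
  have hcUev : ∑' j, φ (PowerSeries.coeff j (PowerSeries.map (padicIntToCoeffIntegers S) cU)) * (ζ - 1) ^ j =
      (((-1 : ℤ[X]) ^ m * cyclotomicOmegaMinus 2 (2 * m)).eval₂ (Int.castRingHom ℂ_[2]) (ζ - 1)) *
        ∑' j, φ (PowerSeries.coeff j (PowerSeries.map (padicIntToCoeffIntegers S) (U : PowerSeries ℤ_[2]))) * (ζ - 1) ^ j := by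
    have hc2 : cU = ((((-1 : ℤ[X]) ^ m * cyclotomicOmegaMinus 2 (2 * m)).map (Int.castRingHom ℤ_[2]) : ℤ_[2][X]) : PowerSeries ℤ_[2]) *
        (U : PowerSeries ℤ_[2]) := by
      rw [hcU, Polynomial.map_mul, Polynomial.map_pow, Polynomial.map_neg, Polynomial.map_one, Polynomial.coe_mul, Polynomial.coe_pow]
      simp
    rw [hc2, map_mul, hφdef, tsum_mul_eval S _ _ hz, tsum_map_coe_eval, Polynomial.eval₂_map]
    congr 1
    congr 1
    exact RingHom.ext_int _ _
  -- (12) `𝔯̃_e(ζ−1) = Σ_i c′_i ε_i`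
  have hr_ev : ∑' k, φ (PowerSeries.coeff k ((∑ i : Fin n, PowerSeries.C (c' i) * e (Pi.single i 1)) * μt)) * (ζ - 1) ^ k =
      (∑ i : Fin n, algebraMap (PadicAlgCl 2) ℂ_[2] (c' i : PadicAlgCl 2) * ε i) * ∑' k, φ (PowerSeries.coeff k μt) * (ζ - 1) ^ k := by
    rw [hφdef, tsum_mul_eval S _ _ hz, tsum_finset_sum_eval S _ _ hz]
    congr 1
    refine Finset.sum_congr rfl fun i _ => ?_
    rw [tsum_C_mul_eval]
  -- (13) assemble
  have hePz : ∑' k, φ (PowerSeries.coeff k (e (P z))) * (ζ - 1) ^ k =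
      ∑ i : Fin n, ε i * (G * ∑ l : Fin π.nb, algebraMap ℚ_[2] ℂ_[2] (π.t₀ (c' i * π.bO l) : ℚ_[2]) * Wc l) := by
    have h1 := hePy 1
    simp only [mul_one] at h1
    rwa [hz1] at h1
  have hLHS : algebraMap (PadicAlgCl 2) ℂ_[2] (3 * q * (δ : PadicAlgCl 2)) *
        (∑' k, φ (PowerSeries.coeff k ((∑ i : Fin n, PowerSeries.C (c' i) * e (Pi.single i 1)) * μt)) * (ζ - 1) ^ k) *
          ((mazurTateElementK g Ω 2 (2 * m)).map ι).eval₂ (algebraMap (PadicAlgCl 2) ℂ_[2]) (ζ - 1) =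
      ∑' k, φ (PowerSeries.coeff k (e (P z))) * (ζ - 1) ^ k := by
    rw [hePz, hT, hr_ev, map_mul, map_mul, hGdef, map_mul]
    have h3 : algebraMap (PadicAlgCl 2) ℂ_[2] (3 : PadicAlgCl 2) = 3 := map_ofNat _ 3
    rw [h3]
    linear_combination (-(algebraMap (PadicAlgCl 2) ℂ_[2] (δ : PadicAlgCl 2) * 3 *
      (∑ i : Fin n, algebraMap (PadicAlgCl 2) ℂ_[2] (c' i : PadicAlgCl 2) * ε i))) * hVr
  change algebraMap (PadicAlgCl 2) ℂ_[2] (3 * q * (δ : PadicAlgCl 2)) *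
        (∑' k, φ (PowerSeries.coeff k ((∑ i : Fin n, PowerSeries.C (c' i) * e (Pi.single i 1)) * μt)) * (ζ - 1) ^ k) *
          ((mazurTateElementK g Ω 2 (2 * m)).map ι).eval₂ (algebraMap (PadicAlgCl 2) ℂ_[2]) (ζ - 1) =
      -(((-1 : ℤ[X]) ^ m * cyclotomicOmegaMinus 2 (2 * m)).eval₂ (Int.castRingHom ℂ_[2]) (ζ - 1)) *
        ∑' k, φ (PowerSeries.coeff k (PowerSeries.map (padicIntToCoeffIntegers S) (U : PowerSeries ℤ_[2]) * e (π.cvec z))) * (ζ - 1) ^ k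
  rw [hLHS]
  change ∑' j, φ (PowerSeries.coeff j (e.toAddMonoidHom (P z))) * (ζ - 1) ^ j =
      -(∑' j, φ (PowerSeries.coeff j (PowerSeries.map (padicIntToCoeffIntegers S) cU)) * (ζ - 1) ^ j) *
        ∑' j, φ (PowerSeries.coeff j (e.toAddMonoidHom (π.cvec z))) * (ζ - 1) ^ j at hcol
  rw [AddEquiv.coe_toAddMonoidHom] at hcol
  rw [hcol, hcUev, hφdef, tsum_mul_eval S _ _ hz]
  ring

end Values

end Summit.BirchSwinnertonDyer.BirchSwinnertonDyer.Theorems.ThetaTransport.StationR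

end
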